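import Summits.CriticalPhenomena.PercolationContinuityZ3.Theorems.PercNearOneGluingNoHeavyLowerTailAntitheticConeFibre
import HarnessLib

/-!
# `NoHeavyLowerTail` (stmt-CriticalPhenomena-4575) — antithetic cluster pairs: **THEOREM R — every rooted cone is R-associated**
# (HOME/THEOREM-R.md, prim-hp-2 gen 60)

Support file (`--supports stmt-CriticalPhenomena-4575`, hull-port prover `prim-hp-2`, gen 60).  No definitions, no named facts, no sorries;
standard axioms.  VERTEX version, setting and notation of …AntitheticConeFibre / …AntitheticTwoStageGraph.

**THEOREM R** (`Antithetic.TwoStage.Cone.R_associated`).  Let `E ⊆ Sym2 V` be an edge set and `s, z` vertices such that, for every colouring `T`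
whose blue cluster `B T = openCluster (Tᶜ ∩ E) z` of `z` misses `s`, every vertex of `B T` is adjacent to `s` (`sv ∈ E`).  [Every rooted cone
`s * H₂`, `H₂` ARBITRARY (`Cone.hcone_of_cone`); more generally `s` adjacent to every vertex of the component of `z` in `E − s`, other blocks at `s`
arbitrary.]  Then for all twisted-monotone `Φ₁, Φ₂ : Set V → Set V → ℝ` (increasing in the first, decreasing in the second argument)
  `(Σ_{T : z ∉ Y T} Φ₁(X T, Y T)) · (Σ_{T : z ∉ Y T} Φ₂(X T, Y T)) ≤ #{T : z ∉ Y T} · Σ_{T : z ∉ Y T} Φ₁ Φ₂ (X T, Y T)`,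
`X T = openCluster (T ∩ E) s`, `Y T = openCluster (Tᶜ ∩ E) s` — literally hypothesis (H2) = `hR` of THEOREM 2H (`Antithetic.TwoStage.change_nonneg`),
which the tree had for fans only (`TwoStage.Fan.R_associated`).  Consequence (…AntitheticTwoStageApexCone): CHANGE ≥ 0 and the vertex antithetic
inequality at `R = {x}` for `({s,y} * H₁) ∪_s (s * H₂) + x`, ALL `H₁, H₂` — CONJECTURE R of HOME/MEMO-gen59 §1.
Proof (HOME/THEOREM-R.md §1) = van den Berg–Häggström–Kahn's proof of their Thm 1.5 run for the pair: `Cone.cond_sum` is BHK's display (10)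
(condition on `B T = S`; on the fibre the pair is the pair of `T ∪ M_S`, `M_S` the pairs meeting `S`, by `Cone.fibre_red/blue/iff`; uniform block
Fubini `Cone.sum_block`), Harris on each fibre (`Cone.harris_real`), monotonicity of the fibre averages in `S`, and BHK Thm 1.3 for the blue vertex
cluster of `z` given `s ∉` it (`Cone.bhk_vertex`, from the tree's `BHK2006.core`).
[cite: VandenbergHaggstromKahn2005, Thm. 1.3 (p. 6), Thm. 1.5 (pp. 7–8, proof with display (10)), §1 p. 6 ("Harris' inequality")]
-/

noncomputable section

namespace Summit.CriticalPhenomena.PercolationContinuityZ3.Theorems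

open Literature.Probability.Percolation
open scoped Classical

namespace Antithetic

namespace TwoStage

namespace Cone

variable {V : Type*} [Fintype V]

/-- **BHK's display (10) for the pair**: conditioning on the blue vertex cluster `S = B T` of `z`,
`Σ_{T : s ∉ B T} Φ(X T, Y T) = Σ_{T : s ∉ B T} av_Φ(B T)` with the fibre average `av_Φ(S) = |Set (Sym2 V)|⁻¹ Σ_{T'} Φ(X (T' ∪ M_S), Y (T' ∪ M_S))`,
`M_S` the pairs meeting `S` — valid under the cone hypothesis on the fibres. [cite: VandenbergHaggstromKahn2005, §1 pp. 7–8, display (10)] -/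
theorem cond_sum (E : Set (Sym2 V)) (s z : V)
    (hcone : ∀ T : Set (Sym2 V), s ∉ openCluster (Tᶜ ∩ E) z → ∀ v ∈ openCluster (Tᶜ ∩ E) z, s(s, v) ∈ E)
    (Φ : Set V → Set V → ℝ) :
    ∑ T : Set (Sym2 V), (if s ∉ openCluster (Tᶜ ∩ E) z then Φ (openCluster (T ∩ E) s) (openCluster (Tᶜ ∩ E) s) else 0) =
    ∑ T : Set (Sym2 V), (if s ∉ openCluster (Tᶜ ∩ E) z then
      (Fintype.card (Set (Sym2 V)) : ℝ)⁻¹ * ∑ T' : Set (Sym2 V),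
        Φ (openCluster ((T' ∪ {e : Sym2 V | ∃ v ∈ e, v ∈ openCluster (Tᶜ ∩ E) z}) ∩ E) s)
          (openCluster ((T' ∪ {e : Sym2 V | ∃ v ∈ e, v ∈ openCluster (Tᶜ ∩ E) z})ᶜ ∩ E) s) else 0) := by
  set N : ℝ := (Fintype.card (Set (Sym2 V)) : ℝ) with hN
  have hNpos : 0 < N := by rw [hN]; exact_mod_cast Fintype.card_pos
  have hNne : N ≠ 0 := hNpos.ne'
  -- abbreviations
  let B : Set (Sym2 V) → Set V := fun T => openCluster (Tᶜ ∩ E) z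
  let M : Set V → Set (Sym2 V) := fun S => {e | ∃ v ∈ e, v ∈ S}
  let W : Set (Sym2 V) → ℝ := fun T => Φ (openCluster (T ∩ E) s) (openCluster (Tᶜ ∩ E) s)
  let av : Set V → ℝ := fun S => N⁻¹ * ∑ T', W (T' ∪ M S)
  -- the identity on each event `{B T = S}`
  have key : ∀ S : Set V,
      ∑ T, (if B T = S then (if s ∉ B T then W T else 0) else 0) = ∑ T, (if B T = S then (if s ∉ B T then av S else 0) else 0) := by
    intro S
    by_cases hsS : s ∈ S
    · -- both sides vanish termwise
      refine Finset.sum_congr rfl fun T _ => ?_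
      by_cases hT : B T = S
      · have h1 : ¬ (s ∉ B T) := fun h => h (by rw [hT]; exact hsS)
        rw [if_pos hT, if_pos hT, if_neg h1, if_neg h1]
      · rw [if_neg hT, if_neg hT]
    · -- block Fubini with the block `M S`
      have hfib : ∀ T, B T = S ↔ B (T ∩ M S) = S := fun T => fibre_iff E z T S
      have h1 : ∀ T, (if B T = S then (if s ∉ B T then W T else 0) else 0) =
          (fun a b : Set (Sym2 V) => if B a = S then W (b ∪ M S) else 0) (T ∩ M S) (T \ M S) := by
        intro T
        show _ = if B (T ∩ M S) = S then W (T \ M S ∪ M S) else 0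
        rw [Set.sdiff_union_self]
        by_cases hT : B T = S
        · have hT' : B (T ∩ M S) = S := (hfib T).1 hT
          have hsT : s ∉ B T := by rw [hT]; exact hsS
          rw [if_pos hT, if_pos hsT, if_pos hT']
          show Φ (openCluster (T ∩ E) s) (openCluster (Tᶜ ∩ E) s) = Φ (openCluster ((T ∪ M S) ∩ E) s) (openCluster ((T ∪ M S)ᶜ ∩ E) s)
          rw [fibre_red E s z hT hsS (fun v hv => hcone T hsT v (by show v ∈ B T; rw [hT]; exact hv)), fibre_blue E s z hT hsS]
        · have hT' : ¬ B (T ∩ M S) = S := fun h => hT ((hfib T).2 h)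
          rw [if_neg hT, if_neg hT']
      have h2 : ∀ T, (if B T = S then (if s ∉ B T then av S else 0) else 0) =
          N⁻¹ * ((if B (T ∩ M S) = S then (1 : ℝ) else 0) * ∑ T', W (T' ∪ M S)) := by
        intro T
        by_cases hT : B T = S
        · have hT' : B (T ∩ M S) = S := (hfib T).1 hT
          have hsT : s ∉ B T := by rw [hT]; exact hsS
          rw [if_pos hT, if_pos hsT, if_pos hT', one_mul]
        · have hT' : ¬ B (T ∩ M S) = S := fun h => hT ((hfib T).2 h)
          rw [if_neg hT, if_neg hT', zero_mul, mul_zero]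
      have h3 : ∀ T, ∑ T', (fun a b : Set (Sym2 V) => if B a = S then W (b ∪ M S) else 0) (T ∩ M S) (T' \ M S) =
          (if B (T ∩ M S) = S then (1 : ℝ) else 0) * ∑ T', W (T' ∪ M S) := by
        intro T
        show ∑ T', (if B (T ∩ M S) = S then W (T' \ M S ∪ M S) else 0) = _
        by_cases hT' : B (T ∩ M S) = S
        · rw [if_pos hT', one_mul]
          exact Finset.sum_congr rfl fun T' _ => by rw [if_pos hT', Set.sdiff_union_self]
        · rw [if_neg hT', zero_mul]
          exact Finset.sum_eq_zero fun T' _ => by rw [if_neg hT']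
      calc ∑ T, (if B T = S then (if s ∉ B T then W T else 0) else 0)
          = ∑ T, (fun a b : Set (Sym2 V) => if B a = S then W (b ∪ M S) else 0) (T ∩ M S) (T \ M S) :=
            Finset.sum_congr rfl fun T _ => h1 T
        _ = N⁻¹ * ∑ T, ∑ T', (fun a b : Set (Sym2 V) => if B a = S then W (b ∪ M S) else 0) (T ∩ M S) (T' \ M S) := by
            rw [sum_block (M S) (fun a b : Set (Sym2 V) => if B a = S then W (b ∪ M S) else 0), ← hN, ← mul_assoc,
              inv_mul_cancel₀ hNne, one_mul]
        _ = N⁻¹ * ∑ T, ((if B (T ∩ M S) = S then (1 : ℝ) else 0) * ∑ T', W (T' ∪ M S)) := by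
            rw [Finset.sum_congr rfl fun T _ => h3 T]
        _ = ∑ T, (if B T = S then (if s ∉ B T then av S else 0) else 0) := by
            rw [Finset.mul_sum]; exact Finset.sum_congr rfl fun T _ => (h2 T).symm
  -- sum over `S` (display (10))
  calc ∑ T, (if s ∉ B T then W T else 0)
      = ∑ T, ∑ S, (if B T = S then (if s ∉ B T then W T else 0) else 0) :=
        Finset.sum_congr rfl fun T _ => (Fintype.sum_ite_eq (B T) fun _ => if s ∉ B T then W T else 0).symm
    _ = ∑ S, ∑ T, (if B T = S then (if s ∉ B T then W T else 0) else 0) := Finset.sum_comm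
    _ = ∑ S, ∑ T, (if B T = S then (if s ∉ B T then av S else 0) else 0) := Finset.sum_congr rfl fun S _ => key S
    _ = ∑ T, ∑ S, (if B T = S then (if s ∉ B T then av S else 0) else 0) := Finset.sum_comm
    _ = ∑ T, (if s ∉ B T then av (B T) else 0) :=
        Finset.sum_congr rfl fun T _ => Fintype.sum_ite_eq (B T) fun S => if s ∉ B T then av S else 0

/-- **THEOREM R** (HOME/THEOREM-R.md): under the cone hypothesis on the blue clusters of `z`, the pair (red cluster, blue cluster) of `s`
conditioned on `z ∉` blue cluster is positively associated for the twisted order — hypothesis (H2) = `hR` of `TwoStage.change_nonneg`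
(THEOREM 2H) for the edge set `E`.  Every rooted cone `s * H₂` qualifies (`Cone.hcone_of_cone`). [this work] -/
theorem R_associated (E : Set (Sym2 V)) (s z : V)
    (hcone : ∀ T : Set (Sym2 V), s ∉ openCluster (Tᶜ ∩ E) z → ∀ v ∈ openCluster (Tᶜ ∩ E) z, s(s, v) ∈ E)
    (Φ₁ Φ₂ : Set V → Set V → ℝ)
    (hΦ₁ : ∀ ⦃A A' B B' : Set V⦄, A ⊆ A' → B' ⊆ B → Φ₁ A B ≤ Φ₁ A' B')
    (hΦ₂ : ∀ ⦃A A' B B' : Set V⦄, A ⊆ A' → B' ⊆ B → Φ₂ A B ≤ Φ₂ A' B') :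
    (∑ T ∈ Finset.univ.filter (fun T : Set (Sym2 V) => z ∉ openCluster (Tᶜ ∩ E) s),
        Φ₁ (openCluster (T ∩ E) s) (openCluster (Tᶜ ∩ E) s)) *
      (∑ T ∈ Finset.univ.filter (fun T : Set (Sym2 V) => z ∉ openCluster (Tᶜ ∩ E) s),
        Φ₂ (openCluster (T ∩ E) s) (openCluster (Tᶜ ∩ E) s)) ≤
    ((Finset.univ.filter fun T : Set (Sym2 V) => z ∉ openCluster (Tᶜ ∩ E) s).card : ℝ) *
      ∑ T ∈ Finset.univ.filter (fun T : Set (Sym2 V) => z ∉ openCluster (Tᶜ ∩ E) s),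
        Φ₁ (openCluster (T ∩ E) s) (openCluster (Tᶜ ∩ E) s) * Φ₂ (openCluster (T ∩ E) s) (openCluster (Tᶜ ∩ E) s) := by
  -- `z ∉ Y T ↔ s ∉ B T`
  have hfilter : Finset.univ.filter (fun T : Set (Sym2 V) => z ∉ openCluster (Tᶜ ∩ E) s) =
      Finset.univ.filter (fun T : Set (Sym2 V) => s ∉ openCluster (Tᶜ ∩ E) z) :=
    Finset.filter_congr fun T _ => not_congr mem_cluster_comm
  rw [hfilter, Finset.sum_filter, Finset.sum_filter, Finset.sum_filter]
  have hcard : ((Finset.univ.filter fun T : Set (Sym2 V) => s ∉ openCluster (Tᶜ ∩ E) z).card : ℝ) =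
      ∑ T : Set (Sym2 V), if s ∉ openCluster (Tᶜ ∩ E) z then (1 : ℝ) else 0 := by
    rw [Finset.card_filter]; push_cast; rfl
  rw [hcard, cond_sum E s z hcone Φ₁, cond_sum E s z hcone Φ₂, cond_sum E s z hcone (fun A B => Φ₁ A B * Φ₂ A B)]
  -- notation
  set N : ℝ := (Fintype.card (Set (Sym2 V)) : ℝ) with hN
  have hNpos : 0 < N := by rw [hN]; exact_mod_cast Fintype.card_pos
  let B : Set (Sym2 V) → Set V := fun T => openCluster (Tᶜ ∩ E) z
  let M : Set V → Set (Sym2 V) := fun S => {e | ∃ v ∈ e, v ∈ S}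
  let X : Set (Sym2 V) → Set V := fun T => openCluster (T ∩ E) s
  let Y : Set (Sym2 V) → Set V := fun T => openCluster (Tᶜ ∩ E) s
  let av₁ : Set V → ℝ := fun S => N⁻¹ * ∑ T', Φ₁ (X (T' ∪ M S)) (Y (T' ∪ M S))
  let av₂ : Set V → ℝ := fun S => N⁻¹ * ∑ T', Φ₂ (X (T' ∪ M S)) (Y (T' ∪ M S))
  let av₁₂ : Set V → ℝ := fun S => N⁻¹ * ∑ T', Φ₁ (X (T' ∪ M S)) (Y (T' ∪ M S)) * Φ₂ (X (T' ∪ M S)) (Y (T' ∪ M S))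
  -- monotonicity in `T'` and in `S`
  have hM : ∀ {S S' : Set V}, S ⊆ S' → M S ⊆ M S' := fun h e ⟨v, hv, hvS⟩ => ⟨v, hv, h hvS⟩
  have hX : ∀ {T T' : Set (Sym2 V)}, T ⊆ T' → X T ⊆ X T' := fun h => Freeze.openCluster_mono (Set.inter_subset_inter_left E h) s
  have hY : ∀ {T T' : Set (Sym2 V)}, T ⊆ T' → Y T' ⊆ Y T := fun h => Freeze.openCluster_mono (Set.inter_subset_inter_left E (Set.compl_subset_compl.2 h)) s
  have hmonoT : ∀ {Φ : Set V → Set V → ℝ}, (∀ ⦃A A' B B' : Set V⦄, A ⊆ A' → B' ⊆ B → Φ A B ≤ Φ A' B') → ∀ S : Set V,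
      Monotone (fun T' : Set (Sym2 V) => Φ (X (T' ∪ M S)) (Y (T' ∪ M S))) := by
    intro Φ hΦ S T₁ T₂ h
    exact hΦ (hX (Set.union_subset_union_left _ h)) (hY (Set.union_subset_union_left _ h))
  have hmonoS : ∀ {Φ : Set V → Set V → ℝ}, (∀ ⦃A A' B B' : Set V⦄, A ⊆ A' → B' ⊆ B → Φ A B ≤ Φ A' B') →
      Monotone (fun S : Set V => N⁻¹ * ∑ T', Φ (X (T' ∪ M S)) (Y (T' ∪ M S))) := by
    intro Φ hΦ S₁ S₂ h
    refine mul_le_mul_of_nonneg_left (Finset.sum_le_sum fun T' _ => ?_) (inv_nonneg.2 hNpos.le)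
    exact hΦ (hX (Set.union_subset_union_right _ (hM h))) (hY (Set.union_subset_union_right _ (hM h)))
  -- Harris on each fibre
  have hH : ∀ S, av₁ S * av₂ S ≤ av₁₂ S := by
    intro S
    have h := harris_real (hmonoT hΦ₁ S) (hmonoT hΦ₂ S)
    rw [← hN] at h
    show N⁻¹ * (∑ T', Φ₁ (X (T' ∪ M S)) (Y (T' ∪ M S))) * (N⁻¹ * ∑ T', Φ₂ (X (T' ∪ M S)) (Y (T' ∪ M S))) ≤
      N⁻¹ * ∑ T', Φ₁ (X (T' ∪ M S)) (Y (T' ∪ M S)) * Φ₂ (X (T' ∪ M S)) (Y (T' ∪ M S))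
    have hi : 0 < N⁻¹ := inv_pos.2 hNpos
    have e : N⁻¹ * (∑ T', Φ₁ (X (T' ∪ M S)) (Y (T' ∪ M S))) * (N⁻¹ * ∑ T', Φ₂ (X (T' ∪ M S)) (Y (T' ∪ M S))) =
        N⁻¹ * N⁻¹ * ((∑ T', Φ₁ (X (T' ∪ M S)) (Y (T' ∪ M S))) * ∑ T', Φ₂ (X (T' ∪ M S)) (Y (T' ∪ M S))) := by ring
    rw [e]
    calc N⁻¹ * N⁻¹ * ((∑ T', Φ₁ (X (T' ∪ M S)) (Y (T' ∪ M S))) * ∑ T', Φ₂ (X (T' ∪ M S)) (Y (T' ∪ M S)))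
        ≤ N⁻¹ * N⁻¹ * (N * ∑ T', Φ₁ (X (T' ∪ M S)) (Y (T' ∪ M S)) * Φ₂ (X (T' ∪ M S)) (Y (T' ∪ M S))) :=
          mul_le_mul_of_nonneg_left h (mul_nonneg hi.le hi.le)
      _ = N⁻¹ * ∑ T', Φ₁ (X (T' ∪ M S)) (Y (T' ∪ M S)) * Φ₂ (X (T' ∪ M S)) (Y (T' ∪ M S)) := by
          field_simp
  -- BHK Thm 1.3 for the blue vertex cluster of `z`, applied to the fibre averages
  have hB := bhk_vertex E s z (a₁ := av₁) (a₂ := av₂) (hmonoS hΦ₁) (hmonoS hΦ₂)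
  have hP : 0 ≤ ∑ T : Set (Sym2 V), if s ∉ openCluster (Tᶜ ∩ E) z then (1 : ℝ) else 0 :=
    Finset.sum_nonneg fun T _ => by split_ifs <;> norm_num
  have hterm : (∑ T : Set (Sym2 V), if s ∉ openCluster (Tᶜ ∩ E) z then av₁ (B T) * av₂ (B T) else 0) ≤
      ∑ T : Set (Sym2 V), if s ∉ openCluster (Tᶜ ∩ E) z then av₁₂ (B T) else 0 :=
    Finset.sum_le_sum fun T _ => by
      by_cases h : s ∉ openCluster (Tᶜ ∩ E) z
      · rw [if_pos h, if_pos h]; exact hH (B T)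
      · rw [if_neg h, if_neg h]
  exact hB.trans (mul_le_mul_of_nonneg_left hterm hP)

omit [Fintype V] in
/-- **Cones satisfy the hypothesis of THEOREM R.**  If every pair of `E₂` lies in `{s} ∪ U₂`, `z ∈ U₂`, and every vertex of `U₂` is adjacent to `s`
(`E₂ ⊇` the spokes of the cone `s * H₂`, `V(H₂) = U₂`), then every vertex of a blue cluster of `z` missing `s` is adjacent to `s`. [this work] -/
theorem hcone_of_cone (E₂ : Set (Sym2 V)) (s z : V) (U₂ : Set V) (hE₂ : ∀ e ∈ E₂, ∀ v ∈ e, v = s ∨ v ∈ U₂) (hz : z ∈ U₂)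
    (hsp : ∀ v ∈ U₂, s(s, v) ∈ E₂) :
    ∀ T : Set (Sym2 V), s ∉ openCluster (Tᶜ ∩ E₂) z → ∀ v ∈ openCluster (Tᶜ ∩ E₂) z, s(s, v) ∈ E₂ := by
  intro T hsT v hv
  have hsub : openCluster (Tᶜ ∩ E₂) z ⊆ {v | v = s ∨ v ∈ U₂} :=
    Fan.cluster_subset_of_closed (Or.inr hz) fun u w _ huw => by
      obtain ⟨⟨_, hE⟩, _⟩ := (openGraph_adj _ u w).1 huw
      exact hE₂ _ hE w (Sym2.mem_mk_right u w)
  rcases hsub hv with rfl | hvU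
  · exact absurd hv hsT
  · exact hsp v hvU

end Cone

end TwoStage

end Antithetic

end Summit.CriticalPhenomena.PercolationContinuityZ3.Theorems
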